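import Summits.Ventures.LatticeQCDFlow.Scaling.SimulatedTemperingDeliveryTime

/-!
HONEST FRAMING: exact (Metropolis-corrected) sampling algorithms for lattice gauge theory; figures
of merit are autocorrelation/cost numbers at stated couplings and volumes; no continuum-physics
claim.

# SimulatedTemperingRoundTrip — THE ROUND-TRIP (COMMUTE) TIME OF THE TEMPERING SAMPLERS ON AN ARBITRARY LADDER IS
# `2(K+1)·Σ_{k<K} 1/ov(β_k, β_{k+1})` (SIMULATED TEMPERING) AND `K(K+1)·Σ_{k<K} 1/swapAcc(β_k, β_{k+1})` ATTEMPTS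
# (REPLICA EXCHANGE): THE HARMONIC SUM OF THE ADJACENT OVERLAPS IS THE LADDER-DESIGN OBJECTIVE (lean-2 GEN-14, ours)

Venture-side (OURS).  Cell `lqcd-flow` (pub-lqcd), unit `pub-lqcd-lean-2-g14`, 2026-08-24.  Continues
`Scaling/SimulatedTemperingDeliveryTime` (`E_0(τ_K) = Σ_k 2(k+1)/ov_k`).  Reflecting the ladder (`k ↦ K − k`, `Fin.rev`)
turns the lumped level walk into the birth–death walk with the up- and down-rates exchanged and reversed
(`bdKernel_rev`), whose Levin–Peres weights are again all `1`; transporting the hitting-time solution along the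
reflection (`isHittingTimeSolution_transport`, the two-kernel form of row 22's `isHittingTimeSolution_comp_equiv`) gives
the RETURN time `E_K(τ_0) = Σ_k 2(K−k)/ov_k`, and adding: the round trip `E_0(τ_K) + E_K(τ_0) = 2(K+1)·Σ_{k<K} 1/ov_k`
— every rung enters with the SAME weight `2(K+1)`, so among ladders with `K` rungs the round trip of the sampler is
minimised exactly by minimising the harmonic sum `Σ_k 1/ov(β_k, β_{k+1})` (row 22's equal-acceptance optimum is the
model-side answer; here the objective itself is derived from the constructed sampler).  `≥ 2K(K+1)` always.

## What is proved (`μ` probability, `X` bounded measurable; `K ≥ 1` for PT)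

* `isHittingTimeSolution_transport`, `bdKernel_rev` (general); `stLevelWalk_rev_bdWeight`;
  **`stLevelWalk_return_time`** (`E_K(τ_0) = Σ_{i<K} 2(i+1)/ov_{K−(i+1)}`); **`stLevelWalk_round_trip`**
  (`= 2(K+1)·Σ_k 1/ov_k`); `stLevelWalk_round_trip_ge` (`≥ 2K(K+1)`).
* PT: `ptLevelWalk_rev_bdWeight`; **`ptLevelWalk_return_time`**; **`ptLevelWalk_round_trip`** (`= K(K+1)·Σ_τ 1/swapAcc_τ`
  attempts).

NOT CLAIMED: path-space identification of hitting times; the optimisation over ladders; anything measured.  Literature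
grade (cell rule): KNOWN RESULT (Levin–Peres (2.13), commute times of birth–death chains) APPLIED; new typing only.
-/

noncomputable section

open MeasureTheory ProbabilityTheory Set Filter Finset
open Summit.Ventures.LatticeQCDFlow.Scoring
open Literature.Probability.MarkovChains
open scoped ENNReal

namespace Summit.Ventures.LatticeQCDFlow.Scaling

/-- **Transport of hitting-time solutions along a bijection between two kernels**: if `P (σ a) (σ b) = P' a b`
then `(a, b) ↦ h (σ a) (σ b)` solves the first-step equations of `P'` whenever `h` solves those of `P`. [folklore] -/
theorem isHittingTimeSolution_transport {Y : Type*} [Fintype Y] [DecidableEq Y] {P P' : Matrix Y Y ℝ}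
    {h : Y → Y → ℝ} (hh : IsHittingTimeSolution P h) (σ : Y ≃ Y) (hσ : ∀ a b, P (σ a) (σ b) = P' a b) :
    IsHittingTimeSolution P' fun a b => h (σ a) (σ b) := by
  refine ⟨fun x => hh.1 (σ x), fun a x hax => ?_⟩
  have hne : σ a ≠ σ x := fun e => hax (σ.injective e)
  show h (σ a) (σ x) = 1 + ∑ y, P' a y * h (σ y) (σ x)
  rw [hh.2 (σ a) (σ x) hne, ← Equiv.sum_comp σ (fun y => P (σ a) y * h y (σ x))]
  simp only [hσ]

/-- **Reflection of a birth–death matrix**: `P(rev i, rev j)` is the birth–death matrix with up-rates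
`k ↦ q(n−k)` and down-rates `k ↦ p(n−k)`. [folklore] -/
theorem bdKernel_rev (n : ℕ) (p q : ℕ → ℝ) (i j : Fin (n + 1)) :
    bdKernel n p q (Fin.rev i) (Fin.rev j) = bdKernel n (fun k => q (n - k)) (fun k => p (n - k)) i j := by
  have hi := i.isLt
  have hj := j.isLt
  have hvi : (Fin.rev i).val = n - i.val := by rw [Fin.val_rev]; omega
  have hvj : (Fin.rev j).val = n - j.val := by rw [Fin.val_rev]; omega
  by_cases hup : j.val = i.val + 1
  · rw [bdKernel_apply_succ hup, bdKernel_apply_pred (show (Fin.rev i).val = (Fin.rev j).val + 1 by omega), hvi]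
  by_cases hdown : i.val = j.val + 1
  · rw [bdKernel_apply_pred hdown, bdKernel_apply_succ (show (Fin.rev j).val = (Fin.rev i).val + 1 by omega), hvi]
  by_cases heq : i = j
  · subst heq
    rw [bdKernel_apply_self, bdKernel_apply_self, hvi]
    ring
  · have hrne : Fin.rev i ≠ Fin.rev j := fun e => heq (Fin.rev_inj.1 e)
    rw [bdKernel_apply_of_ne hup hdown heq,
      bdKernel_apply_of_ne (show (Fin.rev j).val ≠ (Fin.rev i).val + 1 by omega)
        (show (Fin.rev i).val ≠ (Fin.rev j).val + 1 by omega) hrne]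

section ST

variable {Ω : Type*} [MeasurableSpace Ω] {X : Ω → ℝ} {μ : Measure Ω} [IsProbabilityMeasure μ] {β : ℕ → ℝ}
  {K : ℕ} {hit : Fin (K + 1) → Fin (K + 1) → ℝ}

/-- The reflected level walk also has all Levin–Peres weights equal to one (`k ≤ K`). [ours] -/
theorem stLevelWalk_rev_bdWeight (hXm : Measurable X) (hXb : ∃ C, ∀ x, |X x| ≤ C) {k : ℕ} (hk : k ≤ K) :
    bdWeight (fun k => stLadderDown X μ β (K - k)) (fun k => stLadderUp X μ β K (K - k)) k = 1 := by
  induction k with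
  | zero => exact bdWeight_zero _ _
  | succ k ih =>
    rw [bdWeight_succ, ih (by omega), one_mul]
    unfold stLadderUp stLadderDown
    rw [if_neg (by omega), if_pos (by omega), Nat.sub_add_eq]
    exact div_self (ne_of_gt (div_pos (stOverlap_pos hXm hXb _) two_pos))

/-- **THE RETURN TIME, EXACTLY**: `E_K(τ_0) = Σ_{i<K} 2(i+1)/ov_{K−(i+1)}` (`= Σ_k 2(K−k)/ov_k`) for the lumped
level walk. [ours] -/
theorem stLevelWalk_return_time (hXm : Measurable X) (hXb : ∃ C, ∀ x, |X x| ≤ C)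
    (hh : IsHittingTimeSolution (stLevelWalk X μ β K) hit) :
    hit (Fin.last K) 0 = ∑ i : Fin K, 2 * ((i : ℕ) + 1) / stOverlap X μ β (K - ((i : ℕ) + 1)) := by
  have hh0 : IsHittingTimeSolution (bdKernel K (stLadderUp X μ β K) (stLadderDown X μ β)) hit := hh
  have hh' : IsHittingTimeSolution
      (bdKernel K (fun k => stLadderDown X μ β (K - k)) (fun k => stLadderUp X μ β K (K - k)))
      fun a b => hit (Fin.rev a) (Fin.rev b) :=
    isHittingTimeSolution_transport hh0 Fin.revPerm fun a b => bdKernel_rev K _ _ a b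
  have hp : ∀ k, k < K → (fun k => stLadderDown X μ β (K - k)) k ≠ 0 := fun k hk => by
    dsimp only; unfold stLadderDown; rw [if_neg (by omega)]
    exact ne_of_gt (div_pos (stOverlap_pos hXm hXb _) two_pos)
  have hq : ∀ k, 1 ≤ k → k ≤ K → (fun k => stLadderUp X μ β K (K - k)) k ≠ 0 := fun k h1 h2 => by
    dsimp only; unfold stLadderUp; rw [if_pos (by omega)]
    exact ne_of_gt (div_pos (stOverlap_pos hXm hXb _) two_pos)
  have hq0 : (fun k => stLadderUp X μ β K (K - k)) 0 = 0 := by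
    dsimp only; unfold stLadderUp; rw [Nat.sub_zero, if_neg (lt_irrefl K)]
  have key := LevinPeres2017_sec_2_5_sum hh' hq0 hp hq (Fin.zero_le (Fin.last K))
  simp only [Fin.rev_zero, Fin.rev_last] at key
  rw [key]
  refine Finset.sum_congr rfl fun i _ => ?_
  rw [if_pos ⟨by simp, by rw [Fin.val_last]; exact i.isLt⟩,
    LevinPeres2017_eq_2_13_div hh' hq0 hp hq i,
    Finset.sum_congr rfl fun j hj => stLevelWalk_rev_bdWeight hXm hXb (k := j)
      (by have := Finset.mem_range.1 hj; omega),
    Finset.sum_const, Finset.card_range, stLevelWalk_rev_bdWeight hXm hXb (by omega), nsmul_eq_mul, mul_one,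
    mul_one]
  unfold stLadderUp
  rw [if_pos (by omega)]
  push_cast
  rw [div_div_eq_mul_div]; ring

/-- **THE ROUND TRIP (COMMUTE TIME), EXACTLY**: `E_0(τ_K) + E_K(τ_0) = 2(K+1)·Σ_{k<K} 1/ov(β_k, β_{k+1})` — every rung
enters with the same weight; the harmonic sum of the adjacent overlaps is the ladder-design objective. [ours] -/
theorem stLevelWalk_round_trip (hXm : Measurable X) (hXb : ∃ C, ∀ x, |X x| ≤ C)
    (hh : IsHittingTimeSolution (stLevelWalk X μ β K) hit) :
    hit 0 (Fin.last K) + hit (Fin.last K) 0 = 2 * ((K : ℝ) + 1) * ∑ i : Fin K, 1 / stOverlap X μ β i := by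
  rw [stLevelWalk_delivery_time hXm hXb hh, stLevelWalk_return_time hXm hXb hh,
    ← Equiv.sum_comp Fin.revPerm
      (fun i : Fin K => 2 * (((i : ℕ) : ℝ) + 1) / stOverlap X μ β (K - ((i : ℕ) + 1))),
    ← Finset.sum_add_distrib, Finset.mul_sum]
  refine Finset.sum_congr rfl fun i _ => ?_
  have hi := i.isLt
  have e1 : K - (((Fin.revPerm i : Fin K) : ℕ) + 1) = (i : ℕ) := by
    rw [Fin.revPerm_apply, Fin.val_rev]; omega
  have e2 : ((((Fin.revPerm i : Fin K) : ℕ) : ℝ) + 1) = (K : ℝ) - (i : ℕ) := by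
    rw [Fin.revPerm_apply, Fin.val_rev, Nat.cast_sub (by omega)]; push_cast; ring
  rw [e1, e2]
  have h0 := (stOverlap_pos (μ := μ) (β := β) hXm hXb (i : ℕ)).ne'
  field_simp
  ring

/-- **The round trip is at least `2K(K+1)`** (`ov_k ≤ 1`). [ours] -/
theorem stLevelWalk_round_trip_ge (hXm : Measurable X) (hXb : ∃ C, ∀ x, |X x| ≤ C)
    (hh : IsHittingTimeSolution (stLevelWalk X μ β K) hit) :
    2 * (K : ℝ) * (K + 1) ≤ hit 0 (Fin.last K) + hit (Fin.last K) 0 := by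
  rw [stLevelWalk_round_trip hXm hXb hh]
  have hs : (K : ℝ) ≤ ∑ i : Fin K, 1 / stOverlap X μ β i := by
    calc (K : ℝ) = ∑ _i : Fin K, (1 : ℝ) := by simp
      _ ≤ ∑ i : Fin K, 1 / stOverlap X μ β i := Finset.sum_le_sum fun i _ => by
          rw [le_div_iff₀ (stOverlap_pos hXm hXb _), one_mul]; exact stOverlap_le_one hXm hXb _
  have hK : (0 : ℝ) ≤ 2 * ((K : ℝ) + 1) := by positivity
  nlinarith

end ST

section PT

variable {Ω : Type*} [MeasurableSpace Ω] {X : Ω → ℝ} {μ : Measure Ω} [IsProbabilityMeasure μ] {β : ℕ → ℝ}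
  {K : ℕ} {hit : Fin (K + 1) → Fin (K + 1) → ℝ}

/-- The reflected tag walk has all Levin–Peres weights equal to one (`k ≤ K`, `K ≥ 1`). [ours] -/
theorem ptLevelWalk_rev_bdWeight (hXm : Measurable X) (hXb : ∃ C, ∀ x, |X x| ≤ C) (hK : 1 ≤ K) {k : ℕ}
    (hk : k ≤ K) :
    bdWeight (fun k => ptLadderDown X μ β K (K - k)) (fun k => ptLadderUp X μ β K (K - k)) k = 1 := by
  have hKp : (0 : ℝ) < K := by exact_mod_cast hK
  induction k with
  | zero => exact bdWeight_zero _ _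
  | succ k ih =>
    rw [bdWeight_succ, ih (by omega), one_mul]
    unfold ptLadderUp ptLadderDown
    rw [if_neg (by omega), if_pos (by omega), Nat.sub_add_eq, Nat.sub_add_cancel (by omega)]
    exact div_self (ne_of_gt (div_pos (ptSwapAcc_pos hXm hXb _ _) hKp))

/-- **THE PTBC RETURN TIME, EXACTLY**: `E_K(τ_0) = Σ_{i<K} K(i+1)/swapAcc_{K−(i+1)}` attempts (`K ≥ 1`). [ours] -/
theorem ptLevelWalk_return_time (hXm : Measurable X) (hXb : ∃ C, ∀ x, |X x| ≤ C) (hK : 1 ≤ K)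
    (hh : IsHittingTimeSolution (ptLevelWalk X μ β K) hit) :
    hit (Fin.last K) 0 =
      ∑ i : Fin K, (K : ℝ) * ((i : ℕ) + 1) / swapAcc X μ (β (K - ((i : ℕ) + 1))) (β (K - ((i : ℕ) + 1) + 1)) := by
  have hKp : (0 : ℝ) < K := by exact_mod_cast hK
  have hh0 : IsHittingTimeSolution (bdKernel K (ptLadderUp X μ β K) (ptLadderDown X μ β K)) hit := hh
  have hh' : IsHittingTimeSolution
      (bdKernel K (fun k => ptLadderDown X μ β K (K - k)) (fun k => ptLadderUp X μ β K (K - k)))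
      fun a b => hit (Fin.rev a) (Fin.rev b) :=
    isHittingTimeSolution_transport hh0 Fin.revPerm fun a b => bdKernel_rev K _ _ a b
  have hp : ∀ k, k < K → (fun k => ptLadderDown X μ β K (K - k)) k ≠ 0 := fun k hk => by
    dsimp only; unfold ptLadderDown; rw [if_neg (by omega)]
    exact ne_of_gt (div_pos (ptSwapAcc_pos hXm hXb _ _) hKp)
  have hq : ∀ k, 1 ≤ k → k ≤ K → (fun k => ptLadderUp X μ β K (K - k)) k ≠ 0 := fun k h1 h2 => by
    dsimp only; unfold ptLadderUp; rw [if_pos (by omega)]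
    exact ne_of_gt (div_pos (ptSwapAcc_pos hXm hXb _ _) hKp)
  have hq0 : (fun k => ptLadderUp X μ β K (K - k)) 0 = 0 := by
    dsimp only; unfold ptLadderUp; rw [Nat.sub_zero, if_neg (lt_irrefl K)]
  have key := LevinPeres2017_sec_2_5_sum hh' hq0 hp hq (Fin.zero_le (Fin.last K))
  simp only [Fin.rev_zero, Fin.rev_last] at key
  rw [key]
  refine Finset.sum_congr rfl fun i _ => ?_
  rw [if_pos ⟨by simp, by rw [Fin.val_last]; exact i.isLt⟩,
    LevinPeres2017_eq_2_13_div hh' hq0 hp hq i,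
    Finset.sum_congr rfl fun j hj => ptLevelWalk_rev_bdWeight hXm hXb hK (k := j)
      (by have := Finset.mem_range.1 hj; omega),
    Finset.sum_const, Finset.card_range, ptLevelWalk_rev_bdWeight hXm hXb hK (by omega), nsmul_eq_mul, mul_one,
    mul_one]
  unfold ptLadderUp
  rw [if_pos (by omega)]
  push_cast
  rw [div_div_eq_mul_div]; ring

/-- **THE PTBC ROUND TRIP, EXACTLY**: `E_0(τ_K) + E_K(τ_0) = K(K+1)·Σ_{τ<K} 1/swapAcc(β_τ, β_{τ+1})` swap attempts
(`K ≥ 1`): the harmonic sum of the adjacent swap acceptances is the ladder-design objective. [ours] -/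
theorem ptLevelWalk_round_trip (hXm : Measurable X) (hXb : ∃ C, ∀ x, |X x| ≤ C) (hK : 1 ≤ K)
    (hh : IsHittingTimeSolution (ptLevelWalk X μ β K) hit) :
    hit 0 (Fin.last K) + hit (Fin.last K) 0 =
      (K : ℝ) * (K + 1) * ∑ i : Fin K, 1 / swapAcc X μ (β i) (β ((i : ℕ) + 1)) := by
  rw [ptLevelWalk_delivery_time hXm hXb hK hh, ptLevelWalk_return_time hXm hXb hK hh,
    ← Equiv.sum_comp Fin.revPerm (fun i : Fin K =>
      (K : ℝ) * (((i : ℕ) : ℝ) + 1) / swapAcc X μ (β (K - ((i : ℕ) + 1))) (β (K - ((i : ℕ) + 1) + 1))),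
    ← Finset.sum_add_distrib, Finset.mul_sum]
  refine Finset.sum_congr rfl fun i _ => ?_
  have hi := i.isLt
  have e1 : K - (((Fin.revPerm i : Fin K) : ℕ) + 1) = (i : ℕ) := by
    rw [Fin.revPerm_apply, Fin.val_rev]; omega
  have e2 : ((((Fin.revPerm i : Fin K) : ℕ) : ℝ) + 1) = (K : ℝ) - (i : ℕ) := by
    rw [Fin.revPerm_apply, Fin.val_rev, Nat.cast_sub (by omega)]; push_cast; ring
  rw [e1, e2]
  have h0 := (ptSwapAcc_pos (μ := μ) hXm hXb (β (i : ℕ)) (β ((i : ℕ) + 1))).ne'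
  field_simp
  ring

end PT

end Summit.Ventures.LatticeQCDFlow.Scaling

end
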